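import Literature.AlgebraicGeometry.Motives.LinearSubspacesChowNonTorsion
import Literature.AlgebraicGeometry.Motives.ChowProjectiveSpaceLines
import HarnessLib

/-!
# `CH_j(ℙⁿ_k) ≅ ℤ`, generated by the class of a `j`-plane (Fulton, Example 1.9.3 with the degree)

Fulton, *Intersection Theory* (2nd ed. 1998), Example 1.9.3 (a): "`A_k(ℙⁿ)` is generated by `[Lᵏ]`,
`Lᵏ` a `k`-dimensional linear subspace", and §2.5 / Example 2.5.1 (`c₁(𝒪(1))^k ∩ [Lᵏ] = [pt]`,
of degree `1`), whence `A_k(ℙⁿ) = ℤ · [Lᵏ] ≅ ℤ`. The tree has both halves: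

* generation — `ProjectiveSpaceCells.ChowGroup.exists_eq_zsmul_coordGenericPoint`
  (`Motives/ChowProjectiveSpaceLines`, by the cellular decomposition and the localisation sequence);
* freeness — `IsLinearSubspacePoint.zsmul_primeCycle_notMem_ratTrivial_of_id`
  (`Motives/LinearSubspacesChowNonTorsion`, by hyperplane sections `c₁(𝒪(1)) ∩ -` and the degree;
  `k` infinite).

This file assembles them: for an infinite field `k` and `j ≤ n`, **`CH_j(ℙⁿ_k) ≃+ ℤ`**
(`ProjectiveSpaceCells.ChowGroup.nonempty_addEquiv_int_projectiveSpace`), the class of the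
coordinate `j`-plane `Λⱼ = V₊(x_{j+1}, …, xₙ)` having infinite order
(`ProjectiveSpaceCells.not_isOfFinAddOrder_ofPoint_coordGenericPoint`) and generating. Everything is
proved; no named facts.

## References

* W. Fulton, *Intersection Theory*, 2nd ed., Springer (1998): Example 1.9.3 (p. 23), §2.5 and
  Example 2.5.1 (p. 41). [Fulton1998]
-/

noncomputable section

open CategoryTheory AlgebraicGeometry Order

universe u

namespace Literature.AlgebraicGeometry.Motives

namespace ProjectiveSpaceCells

variable (k : Type u) [Field k] {n : ℕ}

/-- The generic point of the coordinate `j`-plane `Λⱼ = V₊(x_{j+1}, …, xₙ)` is a `j`-plane point of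
`ℙⁿ_k` in the sense of `IsLinearSubspacePoint j n (𝟙 ℙⁿ)` (`j ≤ n`). [folklore] -/
theorem isLinearSubspacePoint_coordGenericPoint {j : ℕ} (hj : j ≤ n) :
    IsLinearSubspacePoint j n (𝟙 (projectiveSpace n k)) (coordGenericPoint k (n := n) j) := by
  refine ⟨height_coordGenericPoint k hj, coordForms k n j, linearIndependent_coordForms k n j,
    isHomogeneous_coordForms k n j, ?_⟩
  change id '' closure {coordGenericPoint k j} = _
  rw [Set.image_id, closure_coordGenericPoint, coordSubspace_eq_zeroLocus_range]

/-- **The class `[Λⱼ] ∈ CH_j(ℙⁿ_k)` of the coordinate `j`-plane has infinite order** (`k` infinite,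
`j ≤ n`; Fulton, Example 2.5.1: its `j`-fold hyperplane section is a point, of degree `1`).
[cite: Fulton1998, Example 2.5.1 (p. 41)] -/
theorem not_isOfFinAddOrder_ofPoint_coordGenericPoint [Infinite k] {j : ℕ} (hj : j ≤ n) :
    ¬IsOfFinAddOrder (ChowGroup.ofPoint (X := (projectiveSpace n k).left)
      (coordGenericPoint k (n := n) j) (height_coordGenericPoint k hj)) :=
  ChowGroup.not_isOfFinAddOrder_ofPoint _ fun m hm h =>
    (isLinearSubspacePoint_coordGenericPoint k hj).zsmul_primeCycle_notMem_ratTrivial_of_id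
      (m := (m : ℤ)) (by exact_mod_cast hm.ne') (by rwa [natCast_zsmul])

/-- **`CH_j(ℙⁿ_k) ≅ ℤ` for `j ≤ n`** (`k` infinite), generated by the class of the coordinate
`j`-plane `Λⱼ` (Fulton, Example 1.9.3 (a) together with the degree, §2.5 / Example 2.5.1):
generation is `ChowGroup.exists_eq_zsmul_coordGenericPoint` (`Motives/ChowProjectiveSpaceLines`),
freeness is `not_isOfFinAddOrder_ofPoint_coordGenericPoint`. [cite: Fulton1998, Example 1.9.3 (p. 23) and Example 2.5.1 (p. 41)] -/
theorem ChowGroup.nonempty_addEquiv_int_projectiveSpace [Infinite k] {j : ℕ} (hj : j ≤ n) :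
    Nonempty (ChowGroup (projectiveSpace n k).left j ≃+ ℤ) := by
  refine nonempty_addEquiv_int_of_closure_eq_top
    (S := {ChowGroup.ofPoint (X := (projectiveSpace n k).left) (coordGenericPoint k (n := n) j)
      (height_coordGenericPoint k hj)})
    ?_ (fun x hx => hx) (not_isOfFinAddOrder_ofPoint_coordGenericPoint k hj)
  rw [eq_top_iff]
  intro x _
  obtain ⟨a, ha⟩ := ChowGroup.exists_eq_zsmul_coordGenericPoint k hj x
  rw [ha]
  exact AddSubgroup.zsmul_mem _ (AddSubgroup.subset_closure (Set.mem_singleton _)) a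

end ProjectiveSpaceCells

end Literature.AlgebraicGeometry.Motives

end
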